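import Summits.ABC.StewartYu.PadicG3VbSizesB
import Summits.ABC.StewartYu.PadicG3VbBudget
import Literature.NumberTheory.Transcendental.PadicCW77Assembly
import HarnessLib

/-!
# Cell abc-stewartyu, crux `Y07Odd` (stmt-ABC-19658), `m = 0` branch: the k-step LINES of the inequality pack at `P.schedVb b`
# (level-0, odd-node and symmetric families share one lemma: far branch from `zerosV`, `Λ`-branch from the order `U`)

`Summits/ABC/StewartYu/PadicG3VbLinesK.lean` — cell `abc-stewartyu` (seat p3-g7).  Theorems only, no named fact.
* `kcost_le`: `L0V·(G+1) + (the KC bound of PadicG3VbSizesB) ≤ (5/2 + (33/64)·2^ν)·Zp` at `m = 0`;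
* `kstep_line_Vb`: for `lev ≤ ŜG`, `ν + 1 ≤ n`, a node `|x₁| ≤ NS lev (ν+1)`, an order `|τ| ≤ TordS 0 0`, an interpolation set of size
  `1 ≤ kpts ≤ 2·NS lev ν + 1` and a gain exponent `E` with `zerosV lev ν ≤ G·E`, and `‖Λ/b_{j₀}‖ ≤ e^{−U}`, `8·2ⁿ·Zp + CondFloorV n ≤ U`:
  `max (BwP·‖Λ/b_{j₀}‖·p^{(tS−1)/2}·p^{condExp p kpts tS}) (BwP/(p^m√p)^E) < 1/KC(UcardS₂, PmaxS₂, L0V, HV, ŜG, lev, Lb lev, x₁, τ)`.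

References: Yu. V. Nesterenko, LNM 1819 (2003) §4.2 (4.29)–(4.35).
-/

noncomputable section

open Finset Real
open Literature.NumberTheory.Transcendental
open Literature.NumberTheory.Transcendental.PadicCW77 (condExp)
open Literature.NumberTheory.Transcendental.CW77.Setup (Tau tauNorm)

namespace Summit.ABC.StewartYu

namespace PadicG3Par

variable {n : ℕ} (P : PadicG3Par n)

/-- `CondFloorV` is monotone in the stage. [folklore] -/
theorem CondFloorV_mono {ν ν' : ℕ} (h : ν ≤ ν') : P.CondFloorV ν ≤ P.CondFloorV ν' := by
  unfold CondFloorV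
  obtain ⟨_, hκ0⟩ := P.kappa_le_one
  have hg : 0 ≤ P.g := by linarith [P.one_le_g]
  have h0 : 0 ≤ (2 : ℝ) ^ P.SdG * P.g * P.XV * (Real.log P.p / (P.p - 1)) := by positivity
  have h1 : (2 : ℝ) ^ (ν + 1) ≤ 2 ^ (ν' + 1) := pow_le_pow_right₀ (by norm_num) (by omega)
  calc (2 : ℝ) ^ (ν + 1) * 2 ^ P.SdG * P.g * P.XV * (Real.log P.p / (P.p - 1))
      = 2 ^ (ν + 1) * (2 ^ P.SdG * P.g * P.XV * (Real.log P.p / (P.p - 1))) := by ring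
    _ ≤ 2 ^ (ν' + 1) * (2 ^ P.SdG * P.g * P.XV * (Real.log P.p / (P.p - 1))) := mul_le_mul_of_nonneg_right h1 h0
    _ = _ := by ring

/-- **THE k-STEP COST IN THE UNIT `Zp`** (`m = 0`): `L0V(G+1) + [4 log 2 + 2 lunkV + T₀ʳ·(c_A + c_τ) + 2HV/e + 2AV⁺ + 2htsV 0 + 4htsV ν]
≤ (5/2 + (33/64)·2^ν)·Zp`. [cite: Nesterenko2003, (4.34); shape only] -/
theorem kcost_le (hm : P.m = 0) (hθ : P.θ₀ = 1 / 2) (hNq : P.Nq = P.K) (hK₀ : (P.K₀ : ℝ) = P.p - 1) (hn2 : 2 ≤ n) (ν : ℕ) :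
    P.L0V * (P.G + 1) + (4 * Real.log 2 + 2 * P.lunkV +
      (69 / 4) * (n + 1) * P.LgV * ((P.SdG * Real.log 2 + 43 / 20 * P.HV + 2 * Real.log n) + (P.SdG * Real.log 2 + 23 / 20 * P.HV + 2 * Real.log n)) +
      2 * (P.HV / Real.exp 1) + 2 * (P.L0V * ((P.SdG + n + 6) * Real.log 2)) + 2 * P.htsV 0 + 4 * P.htsV ν) ≤
    (5 / 2) * P.Zp + (33 / 64) * 2 ^ ν * P.Zp := by
  have hNqK : P.Nq ≤ 2 ^ n * P.K := by rw [hNq]; exact Nat.le_mul_of_pos_left _ (by positivity)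
  have hθ' : 1 / 2 ≤ P.θ₀ := by rw [hθ]
  have h1 := P.L0V_G_le hm hθ hNq hK₀
  have h2 := P.lunkV_le
  have h3 := P.T0r_SdG_le hm hθ hNq hK₀ hn2
  have h4 := P.T0r_HV_le
  have h5 := P.T0r_logn_le hm hθ hNq hK₀
  have h6 := P.HV_le_Zp
  have h7 := P.AVp_le
  have h8 := P.htsV_le 0
  have h9 := P.htsV_le ν
  have h10 := P.smallV_le hθ' hNqK
  have hZ := P.Zp_facts.1
  have hg := P.one_le_g
  have hl2 : Real.log 2 < 0.6931471808 := Real.log_two_lt_d9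
  have he : 2 < Real.exp 1 := by have := Real.exp_one_gt_d9; linarith
  have hHV : (0 : ℝ) ≤ P.HV := by positivity
  have hZg : P.Zp / P.g ≤ P.Zp := div_le_self hZ.le hg
  have hHe : P.HV / Real.exp 1 ≤ P.HV / 2 := div_le_div_of_nonneg_left hHV (by norm_num) he.le
  simp only [pow_zero, one_mul] at h8
  nlinarith [h1, h2, h3, h4, h5, h6, h7, h8, h9, h10, hZg, hHe]

end PadicG3Par

namespace G3Setup

variable {p : ℕ} [Fact p.Prime] (S : G3Setup p) (P : PadicG3Par S.n) (b : ℝ)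

set_option maxHeartbeats 400000 in
/-- **THE k-STEP LINE at `P.schedVb b`** (all three k-step families of the pack). [cite: Nesterenko2003, §4.2 (4.29)–(4.35); shape only] -/
theorem kstep_line_Vb (hp : P.p = p) (hm : P.m = 0) (hθ : P.θ₀ = 1 / 2) (hNq : P.Nq = P.K) (hK₀ : (P.K₀ : ℝ) = P.p - 1)
    (hn2 : 2 ≤ S.n) (hb : 1 ≤ b) (hA1 : ∀ j, 1 ≤ P.A j) (hαA : ∀ j, Height.logHeight₁ (S.α j) ≤ P.A j)
    (hbW : ∀ j, Real.log (max 3 (|S.b j| : ℝ)) ≤ P.W)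
    {U : ℝ} (hΛU : ‖S.Λ / (S.b S.j₀ : ℚ_[p])‖ ≤ Real.exp (-U)) (hU : 8 * 2 ^ S.n * P.Zp + P.CondFloorV S.n ≤ U)
    {lev ν : ℕ} (hlev : lev ≤ P.SdG) (hν : ν + 1 ≤ S.n) {x₁ : ℤ} (hx : |x₁| ≤ (S.NS (P.schedVb b) lev (ν + 1) : ℤ))
    (τ : Tau S.n) (hτ : tauNorm τ ≤ S.TordS (P.schedVb b) 0 0)
    {kpts : ℕ} (hk1 : 1 ≤ kpts) (hk : kpts ≤ 2 * S.NS (P.schedVb b) lev ν + 1) {E : ℕ} (hE : P.zerosV lev ν ≤ P.G * E) :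
    max (BwP (p := p) P.L0V P.m * ‖S.Λ / (S.b S.j₀ : ℚ_[p])‖ * (p : ℝ) ^ ((S.tS (P.schedVb b) lev - 1) / 2) *
          (p : ℝ) ^ condExp p kpts (S.tS (P.schedVb b) lev))
        (BwP (p := p) P.L0V P.m / ((p : ℝ) ^ P.m * Real.sqrt p) ^ E) <
      1 / S.KC (S.UcardS₂ (P.schedVb b)) (S.PmaxS₂ (P.schedVb b)) P.L0V P.HV P.SdG lev (S.Lb (S.sideS₂ (P.schedVb b)) lev) x₁ τ := by
  have hn1 : 1 ≤ S.n := by omega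
  have hprime : p.Prime := Fact.out
  have hp2 : 2 ≤ p := hprime.two_le
  have hpR : (2 : ℝ) ≤ p := by exact_mod_cast hp2
  have hNqK : P.Nq ≤ 2 ^ S.n * P.K := by rw [hNq]; exact Nat.le_mul_of_pos_left _ (by positivity)
  have hθ' : 1 / 2 ≤ P.θ₀ := by rw [hθ]
  -- the Liouville constant
  set K : ℝ := S.KC (S.UcardS₂ (P.schedVb b)) (S.PmaxS₂ (P.schedVb b)) P.L0V P.HV P.SdG lev (S.Lb (S.sideS₂ (P.schedVb b)) lev) x₁ τ with hKdef
  have hKlog := S.log_KC_Vb_le P b hb hn1 hA1 hαA hbW hlev hν hx τ hτ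
  rw [← hKdef] at hKlog
  have hKpos : 0 < K := by
    rw [hKdef]; unfold KC
    have hM0 := (M0C_pos P.L0V P.HV P.SdG lev x₁ τ.1).le
    have hP0 : (0 : ℝ) ≤ (S.PmaxS₂ (P.schedVb b) : ℝ) := by linarith [(S.PmaxS₂_le_two_mul (P.schedVb b)).1]
    have hX0 : (0 : ℝ) ≤ (S.XbC (S.Lb (S.sideS₂ (P.schedVb b)) lev) : ℝ) ^ (∑ k, τ.2 k) := pow_nonneg (S.XbC_nonneg _) _
    positivity
  have hKexp : K ≤ Real.exp (4 * Real.log 2 + 2 * P.lunkV +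
      (69 / 4) * (S.n + 1) * P.LgV * ((P.SdG * Real.log 2 + 43 / 20 * P.HV + 2 * Real.log S.n) + (P.SdG * Real.log 2 + 23 / 20 * P.HV + 2 * Real.log S.n)) +
      2 * (P.HV / Real.exp 1) + 2 * (P.L0V * ((P.SdG + S.n + 6) * Real.log 2)) + 2 * P.htsV 0 + 4 * P.htsV ν) := by
    rw [← Real.exp_log hKpos]; exact Real.exp_le_exp.mpr hKlog
  -- the coefficient bound
  have hBwpos : 0 < BwP (p := p) P.L0V P.m := by unfold BwP; positivity
  have hBwexp : BwP (p := p) P.L0V P.m ≤ Real.exp (P.L0V * (P.G + 1)) := by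
    have h := P.log_BwP_shape_le hθ
    rw [hp] at h
    rw [← Real.exp_log hBwpos]
    exact Real.exp_le_exp.mpr h
  -- the cost
  have hcost := P.kcost_le hm hθ hNq hK₀ hn2 ν
  have hZ := P.Zp_facts.1
  have hzeros := P.zerosV_ge' lev ν
  have h2ν : (1 : ℝ) ≤ 2 ^ ν := one_le_pow₀ (by norm_num)
  -- FAR BRANCH
  have hrho : ((p : ℝ) ^ P.m * Real.sqrt p) ^ E = Real.exp (P.G * E) := by
    have h := P.rho_pow_eq_exp hθ E; rw [hp] at h; exact h
  have hfar : BwP (p := p) P.L0V P.m / ((p : ℝ) ^ P.m * Real.sqrt p) ^ E < 1 / K := by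
    rw [hrho, lt_div_iff₀ hKpos, div_mul_eq_mul_div, div_lt_iff₀ (Real.exp_pos _), one_mul]
    calc BwP (p := p) P.L0V P.m * K ≤ Real.exp (P.L0V * (P.G + 1)) * Real.exp (4 * Real.log 2 + 2 * P.lunkV +
      (69 / 4) * (S.n + 1) * P.LgV * ((P.SdG * Real.log 2 + 43 / 20 * P.HV + 2 * Real.log S.n) + (P.SdG * Real.log 2 + 23 / 20 * P.HV + 2 * Real.log S.n)) +
      2 * (P.HV / Real.exp 1) + 2 * (P.L0V * ((P.SdG + S.n + 6) * Real.log 2)) + 2 * P.htsV 0 + 4 * P.htsV ν) :=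
          mul_le_mul hBwexp hKexp hKpos.le (Real.exp_pos _).le
      _ < Real.exp (P.G * E) := by
          rw [← Real.exp_add]
          refine Real.exp_lt_exp.mpr ?_
          have hm1 : P.Zp ≤ 2 ^ ν * P.Zp := le_mul_of_one_le_left hZ.le h2ν
          unfold PadicG3Par.Zp at hcost hZ hm1
          linarith [hcost, hzeros, hE, hm1]
  -- Λ BRANCH
  have hlam : BwP (p := p) P.L0V P.m * ‖S.Λ / (S.b S.j₀ : ℚ_[p])‖ * (p : ℝ) ^ ((S.tS (P.schedVb b) lev - 1) / 2) *
      (p : ℝ) ^ condExp p kpts (S.tS (P.schedVb b) lev) < 1 / K := by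
    -- `p^{(tS−1)/2} ≤ exp(4 LgV log p)`
    have hlogp : 0 ≤ Real.log (p : ℝ) := Real.log_nonneg (by linarith)
    have ht : (S.tS (P.schedVb b) lev - 1) / 2 ≤ 4 * P.LgV := by
      rw [S.tS_Vb P b]; have := P.TV_le lev; omega
    have hpow1 : (p : ℝ) ^ ((S.tS (P.schedVb b) lev - 1) / 2) ≤ Real.exp (4 * P.LgV * Real.log P.p) := by
      rw [hp, ← Real.rpow_natCast, Real.rpow_def_of_pos (by linarith)]
      refine Real.exp_le_exp.mpr ?_
      have : (((S.tS (P.schedVb b) lev - 1) / 2 : ℕ) : ℝ) ≤ 4 * P.LgV := by exact_mod_cast ht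
      nlinarith
    -- `p^{condExp} ≤ exp(AcondV lev ν − 4 LgV log p)`
    have hcond := PadicCW77.condExp_mul_log_le hp2 kpts (S.tS (P.schedVb b) lev)
    obtain ⟨_, hκ0⟩ := P.kappa_le_one
    rw [hp] at hκ0
    have hkR : (kpts : ℝ) ≤ 2 ^ (ν + 1) * P.XsV lev + 1 := by
      have : (kpts : ℝ) ≤ ((2 * S.NS (P.schedVb b) lev ν + 1 : ℕ) : ℝ) := by exact_mod_cast hk
      rw [S.NS_Vb P b] at this; push_cast at this; rw [pow_succ]; linarith
    have hk1R : (1 : ℝ) ≤ kpts := by exact_mod_cast hk1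
    have htS : ((S.tS (P.schedVb b) lev : ℕ) : ℝ) = P.TV lev + 1 := by rw [S.tS_Vb P b]; push_cast; ring
    have hpow2 : (p : ℝ) ^ condExp p kpts (S.tS (P.schedVb b) lev) ≤ Real.exp (P.AcondV lev ν - 4 * P.LgV * Real.log P.p) := by
      have hAdef : P.AcondV lev ν - 4 * P.LgV * Real.log P.p =
          (2 ^ (ν + 1) * P.XsV lev + 1) * (P.TV lev + 1) * (Real.log p / (p - 1)) +
            (P.TV lev + 1) * Real.log (2 * (2 ^ (ν + 1) * P.XsV lev + 1)) := by
        unfold PadicG3Par.AcondV; rw [hp]; ring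
      rw [← Real.rpow_natCast, Real.rpow_def_of_pos (by linarith), hAdef]
      refine Real.exp_le_exp.mpr ?_
      rw [htS] at hcond
      have hlogk : Real.log (2 * (kpts : ℝ)) ≤ Real.log (2 * (2 ^ (ν + 1) * P.XsV lev + 1)) :=
        Real.log_le_log (by linarith) (by linarith)
      have hT0 : (0 : ℝ) ≤ P.TV lev + 1 := by positivity
      have e1 : (kpts : ℝ) * (P.TV lev + 1) * (Real.log p / (p - 1)) ≤
          (2 ^ (ν + 1) * P.XsV lev + 1) * (P.TV lev + 1) * (Real.log p / (p - 1)) :=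
        mul_le_mul_of_nonneg_right (mul_le_mul_of_nonneg_right hkR hT0) hκ0
      have e2 : (P.TV lev + 1 : ℝ) * Real.log (2 * (kpts : ℝ)) ≤ (P.TV lev + 1) * Real.log (2 * (2 ^ (ν + 1) * P.XsV lev + 1)) :=
        mul_le_mul_of_nonneg_left hlogk hT0
      rw [mul_comm]
      linarith [hcond, e1, e2]
    have hAc := P.AcondV_le hθ' hlev (by omega : ν ≤ S.n)
    have hCF := P.CondFloorV_mono (by omega : ν ≤ S.n)
    have h2νn : (2 : ℝ) * 2 ^ ν ≤ 2 ^ S.n := by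
      rw [← pow_succ']; exact pow_le_pow_right₀ (by norm_num) hν
    -- assemble
    rw [lt_div_iff₀ hKpos]
    have hnorm0 : 0 ≤ ‖S.Λ / (S.b S.j₀ : ℚ_[p])‖ := norm_nonneg _
    calc BwP (p := p) P.L0V P.m * ‖S.Λ / (S.b S.j₀ : ℚ_[p])‖ * (p : ℝ) ^ ((S.tS (P.schedVb b) lev - 1) / 2) *
          (p : ℝ) ^ condExp p kpts (S.tS (P.schedVb b) lev) * K
        ≤ Real.exp (P.L0V * (P.G + 1)) * Real.exp (-U) * Real.exp (4 * P.LgV * Real.log P.p) *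
          Real.exp (P.AcondV lev ν - 4 * P.LgV * Real.log P.p) * Real.exp (4 * Real.log 2 + 2 * P.lunkV +
      (69 / 4) * (S.n + 1) * P.LgV * ((P.SdG * Real.log 2 + 43 / 20 * P.HV + 2 * Real.log S.n) + (P.SdG * Real.log 2 + 23 / 20 * P.HV + 2 * Real.log S.n)) +
      2 * (P.HV / Real.exp 1) + 2 * (P.L0V * ((P.SdG + S.n + 6) * Real.log 2)) + 2 * P.htsV 0 + 4 * P.htsV ν) := by
          gcongr
      _ < 1 := by
          rw [← Real.exp_add, ← Real.exp_add, ← Real.exp_add, ← Real.exp_add]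
          rw [Real.exp_lt_one_iff]
          have hm1 : P.Zp ≤ 2 ^ ν * P.Zp := le_mul_of_one_le_left hZ.le h2ν
          have hm2 : (2 * 2 ^ ν) * P.Zp ≤ 2 ^ S.n * P.Zp := mul_le_mul_of_nonneg_right h2νn hZ.le
          have hZ36 := P.Zp_ge
          linarith [hcost, hAc, hCF, hU, hm1, hm2, hZ36]
  exact max_lt hlam hfar

end G3Setup

end Summit.ABC.StewartYu

end
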